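import Literature.MathematicalPhysics.QuantumFieldTheory.Balaban1983to89.T4AveragingDisintegration
import Literature.MathematicalPhysics.QuantumFieldTheory.Balaban1983to89.Node00.TStepOfRecord

/-!
# DAG node N11 — THE DISINTEGRATION TRANSPORT IN A FIBRE CHART (the measure-theoretic socket of [III] §3's «we remove the δ-functions using the operator C», p. 267):
# def-T's `kernelTransport` ∕ `transportOfRecord` of a density supported in a charted set IS, a.e. in the coarse field, the chart's fibre integral with its Jacobian

HEADER — WORK-UNIT METADATA.  Cell `pub-ymgap`, YM-PLAN Track A (HUMAN RULING D-0062), seat `pub-ymgap-dag-n11-d` (g14; R134 fan-out base seat N11 [B14], strategy s2),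
route `BalabanUVNodes` rev 25, item K1⁷ `StabilityBAtRecordR13SepCoPH` = stmt-QuantumFields-20542 (helper lane, `--kind proof --supports 20542 --as helper`, count-neutral).
[I] = [Balaban1987RG1], [III] = [Balaban1988Convergent], [15] = [Balaban1985Variational].  Over node00-def-T's `T4AveragingDisintegration` (`jointLaw`, `margDensity`, `condLaw`,
`kernelTransport`, `integral_kernelTransport_mul`, `ae_eq_of_forall_integral_mul_eq`) and `Node00/TStepOfRecord` (`transportOfRecord = transportK (avOfRecord …).avg`,
`avOfRecord_measurable`, `avOfRecord_haarAC`).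

WHY THIS FILE.  dag-n11-e g20's LOCATED-SALPHA-v3 (pub-ymgap INBOX, 2026-08-28 ≈06:19Z): the operator half (S-α) of [III] §3 now HAS its configuration-level objects in the tree
(exponential chart, multi-scale fibre chart, the linearising transformation (47), the linearised averaging, Haar in exponential coordinates, tree-gauge fixing); what is
MISSING is ONE assembly theorem (B4) — print p. 267 «Finally we remove the δ-functions using the operator C» — identifying def-T's disintegration transport
`condLaw ∕ kernelTransport ∕ transportOfRecord` (the kernel form of `∫ dU δ(ŪV⁻¹) ρ(U)`, an `rnDeriv`-VERSION determined only a.e. in the coarse variable) with the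
explicit chart integral over the fibre.  THIS FILE types the ABSTRACT HALF of (B4): what a fibre chart must deliver, and what follows from it, in pure measure theory over
def-T's names — so that the Lie–Haar ∕ chart computation (the other half: «axial comb ∘ exponential chart ∘ (47)», its Jacobian `∏σ·|det(1 − H∘∂D)|`) plugs in BY NAME.
A FIBRE CHART of the averaging `avg : β → α` for the pair of references `(ν on β, μ on α)` on a charted set `S ⊆ β` is: a fibre-coordinate space `X` with FIBRE REFERENCE
MEASURES `κ : Kernel α X` (s-finite; a `V`-DEPENDENT reference is allowed — e.g. Lebesgue on the linear fibre `ker Q(U₀(V))` of (47) inside a fixed ambient space; a constant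
kernel `Kernel.const α λ` is the product case, `Measure.compProd_const`), a measurable map `Ψ : α × X → β` and a Jacobian `J : α × X → ℝ≥0`, with the two DISPLAYED hypotheses
  `hpush : ((μ ⊗ₘ κ).withDensity J).map Ψ = ν.restrict S`      («`dU` on `S` in the coordinates `(V, x)` is `J(V,x) dV κ_V(dx)`»),
  `hfib  : avg (Ψ (V, x)) = V` for `((μ ⊗ₘ κ).withDensity J)`-a.e. `(V, x)`   («`Ψ(V, ·)` parametrises the fibre over `V`»).
THEN (§1, `ℝ≥0∞`, no integrability anywhere): `∫⁻ φ(avg U)·g(U) dν = ∫⁻ φ(V)·(∫⁻ J(V,x)·g(Ψ(V,x)) κ_V(dx)) dμ` for all measurable `φ, g ≥ 0` with `g = 0` off `S`, i.e. THE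
MEASURE IDENTITY `(ν.withDensity g).map avg = μ.withDensity (V ↦ ∫⁻ J(V,x)·g(Ψ(V,x)) κ_V(dx))` — print's `∫dU δ(ŪV⁻¹) g(U)` computed in the chart, kernel-free; (§2, Bochner) for
every `ν`-integrable real `ρ` vanishing off `S`, def-T's `kernelTransport ν μ avg ρ =ᵐ[μ] V ↦ ∫ J(V,x)·ρ(Ψ(V,x)) κ_V(dx)`, and — for a SATURATED charted set `S = avg⁻¹ T` — the
same μ-a.e. ON `T` for EVERY integrable `ρ`; (§3) the same two faces for def-T's `transportOfRecord F N K k` (`fieldMeasure`, `avOfRecord`, `k < K`).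

WHAT THIS FILE PROVES (0 `def`, 0 `sorry`, standard axioms; generic `{α β X}` then the record).
§1 `lintegral_eq_lintegral_chart_of_support` · ★ `lintegral_comp_avg_mul_eq_chart` · `measurable_lintegral_chart` · ★★ `map_withDensity_eq_withDensity_lintegral_chart`.
§2 `integrable_chart_of_integrable` · `integrable_integral_chart` · ★ `integral_comp_avg_mul_eq_chart` · ★★★ `kernelTransport_ae_eq_integral_chart_of_support` · ★★★ `kernelTransport_ae_eq_integral_chart_on`.
§3 ★★ `transportOfRecord_ae_eq_integral_chart_of_support` · ★★ `transportOfRecord_ae_eq_integral_chart_on`.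

HONEST FRAMING.  Helper lane of K1⁷; count-neutral; pure finite measure theory (push-forward, `withDensity`, Tonelli ∕ Fubini, a.e. uniqueness of the transform) over def-T's
definitions; NO chart is constructed and NO Jacobian computed here — `hpush` ∕ `hfib` are HYPOTHESES a chart seat discharges; nothing of Bałaban ([I] §2, [III] §3 (3.10)–(3.25), [15]
Sect. C (47)–(49)) is asserted; (S-α) ∕ (B4) NOT closed; N11 NOT discharged; K1⁷ NOT closed; counts unmoved (typed 28∕28 · discharged 5∕27).  One finite `𝕋⁴_{L^K}` programme at
fixed `ε = L^{−K}`; R4 closes only the conditional finite-𝕋⁴ rung `BalabanLadder.UV` — NOT ℝ⁴, NOT OS, NOT a mass gap, NOT Clay.  No `sorry`, `axiom`, `def`, `instance`, `notation`.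
Sources (SHAPE ∕ bookkeeping only): [I] (0.4) p.253 (the renormalization transformation `∫dU δ(ŪV⁻¹)…`), Sect. 2 pp.260–262; [III] (2.21) p.258, (3.1) p.264, p.267 L18–24; [15] (47)–(49)
pp.287–288.
-/

noncomputable section

open MeasureTheory ProbabilityTheory
open scoped ENNReal NNReal

namespace Summit.QuantumFields.YangMills.Theorems.BalabanUVNodesN11KernelTransportInFibreChart

open Literature.MathematicalPhysics.QuantumFieldTheory.Balaban1983to89
open Literature.MathematicalPhysics.QuantumFieldTheory.Balaban1983to89.T4AveragingDisintegration

/-! ## §1  The `ℝ≥0∞` identities: `∫dU` on the charted set in the coordinates `(V, x)`; the push-forward of `g·dU` along `avg` has the chart integral as density -/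

section LIntegral

variable {α β X : Type*} [MeasurableSpace α] [MeasurableSpace β] [MeasurableSpace X]
variable {ν : Measure β} {μ : Measure α} [SFinite μ] {κ : Kernel α X} [IsSFiniteKernel κ]
variable {avg : β → α} {Ψ : α × X → β} {J : α × X → ℝ≥0} {S : Set β}

omit [SFinite μ] [IsSFiniteKernel κ] in
/-- **`∫dU` ON THE CHARTED SET IN THE COORDINATES `(V, x)`**: under `hpush`, for every measurable `g ≥ 0` vanishing off `S`,
`∫⁻ g dν = ∫⁻ J(V,x)·g(Ψ(V,x)) d(μ ⊗ₘ κ)`. [cite: Balaban1987RG1, (0.4) p.253; Balaban1988Convergent, p.267 (bookkeeping: change of variables as a push-forward identity)] -/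
theorem lintegral_eq_lintegral_chart_of_support (hΨ : Measurable Ψ) (hJ : Measurable J)
    (hpush : ((μ ⊗ₘ κ).withDensity (fun z => (J z : ℝ≥0∞))).map Ψ = ν.restrict S)
    {g : β → ℝ≥0∞} (hg : Measurable g) (hgS : ∀ U, U ∉ S → g U = 0) :
    ∫⁻ U, g U ∂ν = ∫⁻ z, (J z : ℝ≥0∞) * g (Ψ z) ∂(μ ⊗ₘ κ) := by
  have hsupp : Function.support g ⊆ S := fun U hU => by
    by_contra h
    exact hU (hgS U h)
  rw [← setLIntegral_eq_of_support_subset hsupp, ← hpush, lintegral_map hg hΨ,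
    lintegral_withDensity_eq_lintegral_mul _ (show Measurable fun z : α × X => (J z : ℝ≥0∞) by fun_prop)
      (show Measurable fun z : α × X => g (Ψ z) from hg.comp hΨ)]
  rfl

/-- **★ THE TESTED FORM — `∫dU φ(Ū) g(U) = ∫dV φ(V) ∫κ_V(dx) J(V,x) g(Ψ(V,x))`**: under `hpush` and `hfib`, for all measurable `φ, g ≥ 0` with `g = 0` off `S`.  This IS the
disintegration of `g·dU` along `avg` computed in the chart (Tonelli for `μ ⊗ₘ κ`; the fibre hypothesis replaces `φ(avg(Ψ(V,x)))` by `φ(V)` wherever `J ≠ 0`).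
[cite: Balaban1987RG1, (0.4) p.253; Balaban1988Convergent, (2.21) p.258, p.267] -/
theorem lintegral_comp_avg_mul_eq_chart (havg : Measurable avg) (hΨ : Measurable Ψ) (hJ : Measurable J)
    (hpush : ((μ ⊗ₘ κ).withDensity (fun z => (J z : ℝ≥0∞))).map Ψ = ν.restrict S)
    (hfib : ∀ᵐ z ∂((μ ⊗ₘ κ).withDensity (fun z => (J z : ℝ≥0∞))), avg (Ψ z) = z.1)
    {φ : α → ℝ≥0∞} (hφ : Measurable φ) {g : β → ℝ≥0∞} (hg : Measurable g) (hgS : ∀ U, U ∉ S → g U = 0) :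
    ∫⁻ U, φ (avg U) * g U ∂ν = ∫⁻ V, φ V * ∫⁻ x, (J (V, x) : ℝ≥0∞) * g (Ψ (V, x)) ∂(κ V) ∂μ := by
  have h1 : ∫⁻ U, φ (avg U) * g U ∂ν = ∫⁻ z, (J z : ℝ≥0∞) * (φ (avg (Ψ z)) * g (Ψ z)) ∂(μ ⊗ₘ κ) :=
    lintegral_eq_lintegral_chart_of_support (ν := ν) (g := fun U => φ (avg U) * g U) hΨ hJ hpush
      ((hφ.comp havg).mul hg) (fun U hU => by simp only [hgS U hU, mul_zero])
  rw [h1]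
  -- replace `φ (avg (Ψ z))` by `φ z.1` where the Jacobian does not vanish
  have hfib' : ∀ᵐ z ∂(μ ⊗ₘ κ), (J z : ℝ≥0∞) ≠ 0 → avg (Ψ z) = z.1 := (ae_withDensity_iff (by fun_prop)).1 hfib
  have h2 : (fun z => (J z : ℝ≥0∞) * (φ (avg (Ψ z)) * g (Ψ z))) =ᵐ[μ ⊗ₘ κ] fun z => φ z.1 * ((J z : ℝ≥0∞) * g (Ψ z)) := by
    filter_upwards [hfib'] with z hz
    by_cases hJz : (J z : ℝ≥0∞) = 0
    · simp only [hJz, zero_mul, mul_zero]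
    · rw [hz hJz]; ring
  rw [lintegral_congr_ae h2, Measure.lintegral_compProd (by fun_prop)]
  refine lintegral_congr fun V => ?_
  change ∫⁻ y, φ V * ((J (V, y) : ℝ≥0∞) * g (Ψ (V, y))) ∂(κ V) = _
  exact lintegral_const_mul _ (by fun_prop)

omit [SFinite μ] in
/-- The chart integral `V ↦ ∫ J(V,x)·g(Ψ(V,x)) κ_V(dx)` is measurable (the integrand of Tonelli for kernels). [cite: Balaban1987RG1, (0.4) p.253 (bookkeeping)] -/
theorem measurable_lintegral_chart (hΨ : Measurable Ψ) (hJ : Measurable J) {g : β → ℝ≥0∞} (hg : Measurable g) :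
    Measurable fun V => ∫⁻ x, (J (V, x) : ℝ≥0∞) * g (Ψ (V, x)) ∂(κ V) :=
  Measurable.lintegral_kernel_prod_right' (f := fun z : α × X => (J z : ℝ≥0∞) * g (Ψ z)) (by fun_prop)

/-- **★★ THE MEASURE IDENTITY — «`∫dU δ(ŪV⁻¹) g(U)` COMPUTED IN THE CHART», kernel-free**: under `hpush` and `hfib`, for every measurable `g ≥ 0` vanishing off the charted
set, the push-forward of `g·dU` along the averaging has, with respect to `dV = μ`, THE DENSITY `V ↦ ∫ J(V,x)·g(Ψ(V,x)) κ_V(dx)`: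
`(ν.withDensity g).map avg = μ.withDensity (V ↦ ∫⁻ J(V,x) g(Ψ(V,x)) ∂κ V)`.  Every version of def-T's transport of `g` is a.e. this function (§2).
[cite: Balaban1987RG1, (0.4) p.253; Balaban1988Convergent, (3.1) p.264, p.267 L18–24; Balaban1985Variational, (47)–(49) pp.287–288 (the chart this socket is for)] -/
theorem map_withDensity_eq_withDensity_lintegral_chart (havg : Measurable avg) (hΨ : Measurable Ψ) (hJ : Measurable J)
    (hpush : ((μ ⊗ₘ κ).withDensity (fun z => (J z : ℝ≥0∞))).map Ψ = ν.restrict S)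
    (hfib : ∀ᵐ z ∂((μ ⊗ₘ κ).withDensity (fun z => (J z : ℝ≥0∞))), avg (Ψ z) = z.1)
    {g : β → ℝ≥0∞} (hg : Measurable g) (hgS : ∀ U, U ∉ S → g U = 0) :
    (ν.withDensity g).map avg = μ.withDensity (fun V => ∫⁻ x, (J (V, x) : ℝ≥0∞) * g (Ψ (V, x)) ∂(κ V)) := by
  ext s hs
  rw [Measure.map_apply havg hs, withDensity_apply _ (havg hs), withDensity_apply _ hs,
    ← lintegral_indicator (havg hs), ← lintegral_indicator hs]
  have hind : (fun U => (avg ⁻¹' s).indicator g U) = fun U => (s.indicator (fun _ => (1 : ℝ≥0∞)) (avg U)) * g U := by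
    funext U
    by_cases hU : avg U ∈ s
    · simp [Set.indicator_of_mem, hU]
    · simp [Set.indicator_of_notMem, hU]
  have hind' : (fun V => s.indicator (fun V => ∫⁻ x, (J (V, x) : ℝ≥0∞) * g (Ψ (V, x)) ∂(κ V)) V) =
      fun V => s.indicator (fun _ => (1 : ℝ≥0∞)) V * ∫⁻ x, (J (V, x) : ℝ≥0∞) * g (Ψ (V, x)) ∂(κ V) := by
    funext V
    by_cases hV : V ∈ s
    · simp [Set.indicator_of_mem, hV]
    · simp [Set.indicator_of_notMem, hV]
  rw [hind, hind']
  exact lintegral_comp_avg_mul_eq_chart havg hΨ hJ hpush hfib (measurable_const.indicator hs) hg hgS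

end LIntegral

/-! ## §2  The Bochner identities and def-T's `kernelTransport` in the chart -/

section Integral

variable {α β X : Type*} [MeasurableSpace α] [MeasurableSpace β] [MeasurableSpace X]
variable {ν : Measure β} {μ : Measure α} [SFinite μ] {κ : Kernel α X} [IsSFiniteKernel κ]
variable {avg : β → α} {Ψ : α × X → β} {J : α × X → ℝ≥0} {S : Set β}

omit [SFinite μ] [IsSFiniteKernel κ] in
/-- A `ν`-integrable real density pulled back to the chart with its Jacobian is `(μ ⊗ₘ κ)`-integrable (under `hpush`; the restriction to `S` loses nothing).
[cite: Balaban1987RG1, (0.4) p.253 (bookkeeping)] -/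
theorem integrable_chart_of_integrable (hΨ : Measurable Ψ) (hJ : Measurable J)
    (hpush : ((μ ⊗ₘ κ).withDensity (fun z => (J z : ℝ≥0∞))).map Ψ = ν.restrict S)
    {ρ : β → ℝ} (hρm : Measurable ρ) (hρ : Integrable ρ ν) :
    Integrable (fun z => (J z : ℝ) * ρ (Ψ z)) (μ ⊗ₘ κ) := by
  have h1 : Integrable ρ (ν.restrict S) := hρ.mono_measure Measure.restrict_le_self
  rw [← hpush] at h1
  have h2 : Integrable (ρ ∘ Ψ) ((μ ⊗ₘ κ).withDensity (fun z => (J z : ℝ≥0∞))) :=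
    (integrable_map_measure (hρm.aestronglyMeasurable) hΨ.aemeasurable).1 h1
  have h3 := (integrable_withDensity_iff_integrable_smul hJ).1 h2
  simpa only [NNReal.smul_def, smul_eq_mul, Function.comp_apply] using h3

/-- The fibre integral `V ↦ ∫ J(V,x)·ρ(Ψ(V,x)) κ_V(dx)` of a `ν`-integrable real density is `μ`-integrable (Fubini for `μ ⊗ₘ κ`: the norm fibre integral is integrable and
dominates). [cite: Balaban1987RG1, (0.4) p.253 (bookkeeping)] -/
theorem integrable_integral_chart (hΨ : Measurable Ψ) (hJ : Measurable J)
    (hpush : ((μ ⊗ₘ κ).withDensity (fun z => (J z : ℝ≥0∞))).map Ψ = ν.restrict S)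
    {ρ : β → ℝ} (hρm : Measurable ρ) (hρ : Integrable ρ ν) :
    Integrable (fun V => ∫ x, (J (V, x) : ℝ) * ρ (Ψ (V, x)) ∂(κ V)) μ := by
  have hI : Integrable (fun z => (J z : ℝ) * ρ (Ψ z)) (μ ⊗ₘ κ) := integrable_chart_of_integrable hΨ hJ hpush hρm hρ
  have hFm : Measurable fun z : α × X => (J z : ℝ) * ρ (Ψ z) := by fun_prop
  have hN := ((Measure.integrable_compProd_iff hI.aestronglyMeasurable).1 hI).2
  have hsm : StronglyMeasurable fun V => ∫ x, (J (V, x) : ℝ) * ρ (Ψ (V, x)) ∂(κ V) :=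
    hFm.stronglyMeasurable.integral_kernel_prod_right' (f := fun z : α × X => (J z : ℝ) * ρ (Ψ z))
  refine hN.mono' hsm.aestronglyMeasurable (Filter.Eventually.of_forall fun V => ?_)
  exact norm_integral_le_integral_norm _

/-- **★ THE TESTED BOCHNER FORM — `∫dU φ(Ū) ρ(U) = ∫dV φ(V) ∫κ_V(dx) J(V,x) ρ(Ψ(V,x))`** for a `ν`-integrable real `ρ` vanishing off `S` and a bounded measurable test
function `φ` of the coarse field (Fubini on the integrable pull-back; the fibre hypothesis as in §1). [cite: Balaban1987RG1, (0.4) p.253; Balaban1988Convergent, (2.21) p.258, p.267] -/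
theorem integral_comp_avg_mul_eq_chart (havg : Measurable avg) (hΨ : Measurable Ψ) (hJ : Measurable J)
    (hpush : ((μ ⊗ₘ κ).withDensity (fun z => (J z : ℝ≥0∞))).map Ψ = ν.restrict S)
    (hfib : ∀ᵐ z ∂((μ ⊗ₘ κ).withDensity (fun z => (J z : ℝ≥0∞))), avg (Ψ z) = z.1)
    {ρ : β → ℝ} (hρm : Measurable ρ) (hρ : Integrable ρ ν) (hρS : ∀ U, U ∉ S → ρ U = 0)
    {φ : α → ℝ} (hφ : Measurable φ) {C : ℝ} (hC : ∀ V, |φ V| ≤ C) :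
    ∫ U, φ (avg U) * ρ U ∂ν = ∫ V, φ V * ∫ x, (J (V, x) : ℝ) * ρ (Ψ (V, x)) ∂(κ V) ∂μ := by
  -- the left side lives on `S`
  have hL : ∫ U, φ (avg U) * ρ U ∂ν = ∫ U, φ (avg U) * ρ U ∂(ν.restrict S) := by
    rw [setIntegral_eq_integral_of_forall_compl_eq_zero]
    intro U hU
    rw [hρS U hU, mul_zero]
  rw [hL, ← hpush, integral_map hΨ.aemeasurable (show Measurable fun U => φ (avg U) * ρ U from (hφ.comp havg).mul hρm).aestronglyMeasurable,
    integral_withDensity_eq_integral_smul hJ]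
  -- integrability of the pull-back with the bounded test function
  have hI : Integrable (fun z => (J z : ℝ) * ρ (Ψ z)) (μ ⊗ₘ κ) := integrable_chart_of_integrable hΨ hJ hpush hρm hρ
  have hIφ : Integrable (fun z => φ z.1 * ((J z : ℝ) * ρ (Ψ z))) (μ ⊗ₘ κ) :=
    hI.bdd_mul (c := C) (hφ.comp measurable_fst).aestronglyMeasurable (Filter.Eventually.of_forall fun z => by
      simpa only [Function.comp_apply, Real.norm_eq_abs] using hC z.1)
  -- replace `φ (avg (Ψ z))` by `φ z.1` where the Jacobian does not vanish
  have hfib' : ∀ᵐ z ∂(μ ⊗ₘ κ), (J z : ℝ≥0∞) ≠ 0 → avg (Ψ z) = z.1 := (ae_withDensity_iff (by fun_prop)).1 hfib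
  have h2 : (fun z => J z • (φ (avg (Ψ z)) * ρ (Ψ z))) =ᵐ[μ ⊗ₘ κ] fun z => φ z.1 * ((J z : ℝ) * ρ (Ψ z)) := by
    filter_upwards [hfib'] with z hz
    by_cases hJz : J z = 0
    · simp only [hJz, zero_smul, NNReal.coe_zero, zero_mul, mul_zero]
    · rw [hz (by exact_mod_cast hJz), NNReal.smul_def, smul_eq_mul]; ring
  have h2' : ∫ z, J z • ((fun U => φ (avg U) * ρ U) (Ψ z)) ∂(μ ⊗ₘ κ) = ∫ z, φ z.1 * ((J z : ℝ) * ρ (Ψ z)) ∂(μ ⊗ₘ κ) :=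
    integral_congr_ae h2
  rw [h2', Measure.integral_compProd hIφ]
  refine integral_congr_ae (Filter.Eventually.of_forall fun V => ?_)
  change ∫ y, φ V * ((J (V, y) : ℝ) * ρ (Ψ (V, y))) ∂(κ V) = _
  exact integral_const_mul (φ V) _

variable [StandardBorelSpace β] [Nonempty β] [IsFiniteMeasure ν] [SigmaFinite μ]

omit [SFinite μ] in
/-- **★★★ def-T's DISINTEGRATION TRANSPORT IN THE CHART, FOR A DENSITY SUPPORTED IN THE CHARTED SET**: under `hpush`, `hfib` and the absolute continuity `ν.map avg ≪ μ`
(def-T's `HaarAC`), for every `ν`-integrable real `ρ` vanishing off `S`,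
`kernelTransport ν μ avg ρ =ᵐ[μ] V ↦ ∫ J(V,x)·ρ(Ψ(V,x)) κ_V(dx)` — print's `∫ dU δ(ŪV⁻¹) ρ(U)` ([I] (0.4)) IS the chart's fibre integral, a.e. in `V` (def-T's version caveat: the
transport is an `rnDeriv`-version).  Proof: both sides have the same integrals against every bounded measurable test function of `V` (`integral_kernelTransport_mul` vs the
tested form above), then def-T's `ae_eq_of_forall_integral_mul_eq`. [cite: Balaban1987RG1, (0.4) p.253, Sect. 2 pp.260–262; Balaban1988Convergent, (3.1) p.264, p.267 L18–24; Balaban1985Variational, (47)–(49) pp.287–288] -/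
theorem kernelTransport_ae_eq_integral_chart_of_support (havg : Measurable avg) (hac : ν.map avg ≪ μ) (hΨ : Measurable Ψ) (hJ : Measurable J)
    (hpush : ((μ ⊗ₘ κ).withDensity (fun z => (J z : ℝ≥0∞))).map Ψ = ν.restrict S)
    (hfib : ∀ᵐ z ∂((μ ⊗ₘ κ).withDensity (fun z => (J z : ℝ≥0∞))), avg (Ψ z) = z.1)
    {ρ : β → ℝ} (hρm : Measurable ρ) (hρ : Integrable ρ ν) (hρS : ∀ U, U ∉ S → ρ U = 0) :
    kernelTransport ν μ avg ρ =ᵐ[μ] fun V => ∫ x, (J (V, x) : ℝ) * ρ (Ψ (V, x)) ∂(κ V) := by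
  refine ae_eq_of_forall_integral_mul_eq (integrable_kernelTransport ν μ havg hac hρ) (integrable_integral_chart hΨ hJ hpush hρm hρ)
    fun f hf ⟨C, hC⟩ => ?_
  rw [integral_kernelTransport_mul ν μ havg hac hρ hf hC]
  have h := integral_comp_avg_mul_eq_chart havg hΨ hJ hpush hfib hρm hρ hρS hf hC
  calc ∫ U, ρ U * f (avg U) ∂ν = ∫ U, f (avg U) * ρ U ∂ν := by
        refine integral_congr_ae (Filter.Eventually.of_forall fun U => mul_comm _ _)
    _ = ∫ V, f V * ∫ x, (J (V, x) : ℝ) * ρ (Ψ (V, x)) ∂(κ V) ∂μ := h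
    _ = ∫ V, (∫ x, (J (V, x) : ℝ) * ρ (Ψ (V, x)) ∂(κ V)) * f V ∂μ := by
        refine integral_congr_ae (Filter.Eventually.of_forall fun V => mul_comm _ _)

omit [SFinite μ] in
/-- **★★★ THE SAME ON A SATURATED CHARTED SET, FOR EVERY DENSITY**: if the chart covers a whole preimage `S = avg⁻¹ T` (`T` measurable), then for EVERY `ν`-integrable real `ρ`
the transport is the chart's fibre integral μ-a.e. ON `T` (test functions supported in `T` only see `ρ` on `S`).
[cite: Balaban1987RG1, (0.4) p.253; Balaban1988Convergent, (3.1) p.264, p.267 L18–24] -/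
theorem kernelTransport_ae_eq_integral_chart_on (havg : Measurable avg) (hac : ν.map avg ≪ μ) (hΨ : Measurable Ψ) (hJ : Measurable J)
    {T : Set α} (hT : MeasurableSet T)
    (hpush : ((μ ⊗ₘ κ).withDensity (fun z => (J z : ℝ≥0∞))).map Ψ = ν.restrict (avg ⁻¹' T))
    (hfib : ∀ᵐ z ∂((μ ⊗ₘ κ).withDensity (fun z => (J z : ℝ≥0∞))), avg (Ψ z) = z.1)
    {ρ : β → ℝ} (hρm : Measurable ρ) (hρ : Integrable ρ ν) :
    ∀ᵐ V ∂μ, V ∈ T → kernelTransport ν μ avg ρ V = ∫ x, (J (V, x) : ℝ) * ρ (Ψ (V, x)) ∂(κ V) := by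
  -- the density cut down to the saturated set
  set ρ' : β → ℝ := fun U => (avg ⁻¹' T).indicator ρ U with hρ'
  have hρ'm : Measurable ρ' := hρm.indicator (havg hT)
  have hρ'i : Integrable ρ' ν := hρ.indicator (havg hT)
  have hρ'S : ∀ U, U ∉ avg ⁻¹' T → ρ' U = 0 := fun U hU => Set.indicator_of_notMem hU _
  have h1 := kernelTransport_ae_eq_integral_chart_of_support havg hac hΨ hJ hpush hfib hρ'm hρ'i hρ'S
  -- on `T` the transports of `ρ` and `ρ'` agree a.e.: both integrate the same against test functions supported in `T`
  have h2 : ∀ᵐ V ∂μ, V ∈ T → kernelTransport ν μ avg ρ V = kernelTransport ν μ avg ρ' V := by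
    have key : (fun V => T.indicator (kernelTransport ν μ avg ρ) V) =ᵐ[μ] fun V => T.indicator (kernelTransport ν μ avg ρ') V := by
      refine ae_eq_of_forall_integral_mul_eq ((integrable_kernelTransport ν μ havg hac hρ).indicator hT)
        ((integrable_kernelTransport ν μ havg hac hρ'i).indicator hT) fun f hf ⟨C, hC⟩ => ?_
      have e : ∀ r : α → ℝ, (fun V => T.indicator r V * f V) = fun V => r V * (T.indicator (fun _ => (1 : ℝ)) V * f V) := by
        intro r; funext V; by_cases hV : V ∈ T <;> simp [hV]
      have hf' : Measurable fun V => T.indicator (fun _ => (1 : ℝ)) V * f V := (measurable_const.indicator hT).mul hf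
      have hC' : ∀ V, |T.indicator (fun _ => (1 : ℝ)) V * f V| ≤ max C 0 := fun V => by
        by_cases hV : V ∈ T
        · simp only [Set.indicator_of_mem hV, one_mul]; exact (hC V).trans (le_max_left _ _)
        · simp only [Set.indicator_of_notMem hV, zero_mul, abs_zero]; exact le_max_right _ _
      rw [e, e, integral_kernelTransport_mul ν μ havg hac hρ hf' hC', integral_kernelTransport_mul ν μ havg hac hρ'i hf' hC']
      refine integral_congr_ae (Filter.Eventually.of_forall fun U => ?_)
      by_cases hU : avg U ∈ T
      · simp only [hρ', Set.indicator_of_mem (show U ∈ avg ⁻¹' T from hU)]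
      · simp only [Set.indicator_of_notMem hU, zero_mul, mul_zero]
    filter_upwards [key] with V hV hVT
    simpa only [Set.indicator_of_mem hVT] using hV
  -- on the chart side `ρ' ∘ Ψ = ρ ∘ Ψ` wherever the Jacobian does not vanish (the chart lands in the fibre over `V ∈ T`)
  have hfib' : ∀ᵐ z ∂(μ ⊗ₘ κ), (J z : ℝ≥0∞) ≠ 0 → avg (Ψ z) = z.1 := (ae_withDensity_iff (by fun_prop)).1 hfib
  have h3 : ∀ᵐ V ∂μ, V ∈ T → ∫ x, (J (V, x) : ℝ) * ρ' (Ψ (V, x)) ∂(κ V) = ∫ x, (J (V, x) : ℝ) * ρ (Ψ (V, x)) ∂(κ V) := by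
    filter_upwards [Measure.ae_ae_of_ae_compProd hfib'] with V hV hVT
    refine integral_congr_ae ?_
    filter_upwards [hV] with x hx
    by_cases hJz : J (V, x) = 0
    · simp only [hJz, NNReal.coe_zero, zero_mul]
    · have hmem : Ψ (V, x) ∈ avg ⁻¹' T := by
        show avg (Ψ (V, x)) ∈ T
        rw [hx (by exact_mod_cast hJz)]; exact hVT
      simp only [hρ', Set.indicator_of_mem hmem]
  filter_upwards [h1, h2, h3] with V hV1 hV2 hV3 hVT
  rw [hV2 hVT, hV1, hV3 hVT]

end Integral

/-! ## §3  At the record: def-T's one-step transport `transportOfRecord F N K k` along Bałaban's averaging of record -/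

section Record

open Node00 hiding SU
open T4Continuum

variable {F : T4Family} {N : ℕ} [NeZero N]
variable {X : Type*} [MeasurableSpace X]
variable {K k : ℕ} {κ : Kernel (GaugeField (F.P K) (k + 1) (SU N)) X} [IsSFiniteKernel κ]
variable {Ψ : GaugeField (F.P K) (k + 1) (SU N) × X → GaugeField (F.P K) k (SU N)} {J : GaugeField (F.P K) (k + 1) (SU N) × X → ℝ≥0}

/-- **★★ THE TRANSPORT OF RECORD IN A FIBRE CHART, DENSITY SUPPORTED IN THE CHARTED SET**: for `k < K` (def-T's `HaarAC` by `avOfRecord_haarAC`), a fibre chart `(X, κ, Ψ, J)` of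
`avOfRecord F N K k` on `S` for the pair `(dU, dV) = (fieldMeasure k, fieldMeasure (k+1))` and a `dU`-integrable density `ρ` vanishing off `S`:
`transportOfRecord F N K k ρ =ᵐ[dV] V ↦ ∫ J(V,x)·ρ(Ψ(V,x)) κ_V(dx)`. [cite: Balaban1988Convergent, (3.1) p.264, p.267 L18–24; Balaban1987RG1, (0.4) p.253] -/
theorem transportOfRecord_ae_eq_integral_chart_of_support (hk : k < K) (hΨ : Measurable Ψ) (hJ : Measurable J) {S : Set (GaugeField (F.P K) k (SU N))}
    (hpush : (((fieldMeasure (F.P K) (k + 1) (SU N)) ⊗ₘ κ).withDensity (fun z => (J z : ℝ≥0∞))).map Ψ = (fieldMeasure (F.P K) k (SU N)).restrict S)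
    (hfib : ∀ᵐ z ∂(((fieldMeasure (F.P K) (k + 1) (SU N)) ⊗ₘ κ).withDensity (fun z => (J z : ℝ≥0∞))), (avOfRecord F N K k).avg (Ψ z) = z.1)
    {ρ : Density (F.P K) k (SU N)} (hρm : Measurable ρ) (hρ : Integrable ρ (fieldMeasure (F.P K) k (SU N))) (hρS : ∀ U, U ∉ S → ρ U = 0) :
    transportOfRecord F N K k ρ =ᵐ[fieldMeasure (F.P K) (k + 1) (SU N)] fun V => ∫ x, (J (V, x) : ℝ) * ρ (Ψ (V, x)) ∂(κ V) :=
  kernelTransport_ae_eq_integral_chart_of_support (avOfRecord_measurable F N K k) (avOfRecord_haarAC F N K k hk) hΨ hJ hpush hfib hρm hρ hρS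

/-- **★★ THE TRANSPORT OF RECORD IN A FIBRE CHART ON A SATURATED CHARTED SET `avg⁻¹ T`, EVERY DENSITY**: the identity `dV`-a.e. ON `T`.
[cite: Balaban1988Convergent, (3.1) p.264, p.267 L18–24; Balaban1987RG1, (0.4) p.253] -/
theorem transportOfRecord_ae_eq_integral_chart_on (hk : k < K) (hΨ : Measurable Ψ) (hJ : Measurable J) {T : Set (GaugeField (F.P K) (k + 1) (SU N))}
    (hT : MeasurableSet T)
    (hpush : (((fieldMeasure (F.P K) (k + 1) (SU N)) ⊗ₘ κ).withDensity (fun z => (J z : ℝ≥0∞))).map Ψ =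
      (fieldMeasure (F.P K) k (SU N)).restrict ((avOfRecord F N K k).avg ⁻¹' T))
    (hfib : ∀ᵐ z ∂(((fieldMeasure (F.P K) (k + 1) (SU N)) ⊗ₘ κ).withDensity (fun z => (J z : ℝ≥0∞))), (avOfRecord F N K k).avg (Ψ z) = z.1)
    {ρ : Density (F.P K) k (SU N)} (hρm : Measurable ρ) (hρ : Integrable ρ (fieldMeasure (F.P K) k (SU N))) :
    ∀ᵐ V ∂(fieldMeasure (F.P K) (k + 1) (SU N)), V ∈ T → transportOfRecord F N K k ρ V = ∫ x, (J (V, x) : ℝ) * ρ (Ψ (V, x)) ∂(κ V) :=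
  kernelTransport_ae_eq_integral_chart_on (avOfRecord_measurable F N K k) (avOfRecord_haarAC F N K k hk) hΨ hJ hT hpush hfib hρm hρ

end Record

end Summit.QuantumFields.YangMills.Theorems.BalabanUVNodesN11KernelTransportInFibreChart

end
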